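import Literature.AlgebraicGeometry.HodgeTheory.MiddleDimensionReductionOfDeRham
import Literature.AlgebraicGeometry.HodgeTheory.HodgeFiltrationModelsReductionProofs
import Literature.AlgebraicGeometry.HodgeTheory.ComplexConjugationHolds
import HarnessLib

/-!
# BFNP Lemma 48 (`middleDimensionReduction`) is one named fact away: the multiplicative de Rham theorem

Theorems-only leaf companion (no definition, no named fact) of `MiddleDimensionReduction`
(the named fact `Literature.AlgebraicGeometry.HodgeTheory.middleDimensionReduction`;
P. Brosnan, H. Fang, Z. Nie, G. Pearlstein, *Singularities of admissible normal functions*,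
Invent. Math. 177 (2009), §6, Lemma 48: the Hodge conjecture for all smooth projective complex
varieties follows from its middle-degree case on even-dimensional ones), written for the
librarian's fact decomposition of 2026-08-16 (mode `fact-decompose`, unit `libsplit-08`).

`MiddleDimensionReductionOfDeRham.middleDimensionReduction_of_exists_deRhamIsoFamily hA hI hdR`
derives the fact from three named facts: (A) Hodge models of smooth projective varieties
(`nonempty_hodgeModel`), (I) independence of `H^{p,q}` from the Hodge model
(`hodgePQ_independent_of_hodgeModel`) and (dR) de Rham's theorem in its MULTIPLICATIVE form
(`Literature.NumberTheory.Transcendental.exists_deRhamIsoFamily 𝓘(ℝ, E)`: a natural,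
multiplicative, normalised family `H^k_dR(M; ℝ) ≃ H^k(M; ℝ)`). Since then (A) and (I) have been
DISCHARGED in the tree — `nonempty_hodgeModel_holds` (`ComplexConjugationHolds`, through Serre's
analytification, the natural integration de Rham family of `DeRhamTheoremProofs` and the Hodge
decomposition `Motives.isInternal_hodgePQ_holds`) and `hodgePQ_independent_of_hodgeModel_holds`
(`HodgeFiltrationModelsReductionProofs`, through `NaturalDeRhamComparisonRigidity_holds`). Hence:

* `middleDimensionReduction_of_multiplicative_deRham` — **(dR) alone implies
  `middleDimensionReduction`**. The multiplicativity clause of (dR) is used exactly once, for the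
  Hodge bidegree of cup products on `X × ℙʳ` (`cupPreservesHodgeType_of_nonempty_hodgeModel`,
  the product half of the printed proof); the natural normalised integration family
  (`exists_isNatural_deRhamIsoFamily`) is already a theorem, so what is missing is Warner's
  Thm. 5.45 / Bott–Tu Thm. 15.8 ("the de Rham isomorphism carries wedge to cup") for it.
* `hodgeConjectureFor_of_middleDimension_of_multiplicative_deRham` — with (dR), the
  middle-dimensional statement gives `HodgeConjectureFor n X` for every smooth projective `X`
  (Hodge models now being a theorem).

Decision recorded for the fact decomposition: NO split of `middleDimensionReduction` (its only
remaining input is the existing named fact `exists_deRhamIsoFamily`; any child would restate it);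
the fact is `blocked-on: Literature.NumberTheory.Transcendental.exists_deRhamIsoFamily` and closes
by the one-liner `middleDimensionReduction_of_multiplicative_deRham ‹_›` when that lands.

## References

* P. Brosnan, H. Fang, Z. Nie, G. Pearlstein, Invent. Math. 177 (2009), §6, Lemma 48.
  [BrosnanFangNiePearlstein2009]
* F. W. Warner, *Foundations of Differentiable Manifolds and Lie Groups*, GTM 94 (1983),
  Thm. 5.36, Thm. 5.45. [WarnerGTM94]
-/

noncomputable section

open scoped Manifold ContDiff

namespace Literature.AlgebraicGeometry.HodgeTheory

/-- **BFNP Lemma 48 from the multiplicative de Rham theorem alone.** If for every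
finite-dimensional complex normed space `E` there is a natural, multiplicative, normalised real
de Rham isomorphism family over the manifolds charted on `E` (`exists_deRhamIsoFamily 𝓘(ℝ, E)`;
de Rham 1931, Warner Thms. 5.36/5.45), then `middleDimensionReduction` holds: if every rational
middle-degree Hodge class on every even-dimensional smooth projective complex variety is
algebraic, so is every rational `(p,p)`-class on every smooth projective complex variety.
`middleDimensionReduction_of_exists_deRhamIsoFamily` fed with the theorems
`nonempty_hodgeModel_holds` and `hodgePQ_independent_of_hodgeModel_holds`. Relies on: the
hypothesis `hdR` (an unproved named fact) only. [cite: BrosnanFangNiePearlstein2009, §6 Lemma 48]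
[cite: WarnerGTM94, Thm. 5.36 / Thm. 5.45] -/
theorem middleDimensionReduction_of_multiplicative_deRham
    (hdR : ∀ (E : Type) [NormedAddCommGroup E] [NormedSpace ℂ E] [FiniteDimensional ℂ E],
      Literature.NumberTheory.Transcendental.exists_deRhamIsoFamily 𝓘(ℝ, E)) :
    middleDimensionReduction :=
  middleDimensionReduction_of_exists_deRhamIsoFamily (fun _ _ ↦ nonempty_hodgeModel_holds)
    hodgePQ_independent_of_hodgeModel_holds hdR

/-- **The Hodge conjecture from its middle-dimensional case, given the multiplicative de Rham
theorem**: for every smooth projective `X/ℂ` of dimension `n`, if every rational middle-degree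
Hodge class on every even-dimensional smooth projective complex variety is algebraic then
`HodgeConjectureFor n X` (Hodge models exist by `nonempty_hodgeModel_holds`). Relies on: `hdR`.
[cite: BrosnanFangNiePearlstein2009, §6 Lemma 48] -/
theorem hodgeConjectureFor_of_middleDimension_of_multiplicative_deRham
    (hdR : ∀ (E : Type) [NormedAddCommGroup E] [NormedSpace ℂ E] [FiniteDimensional ℂ E],
      Literature.NumberTheory.Transcendental.exists_deRhamIsoFamily 𝓘(ℝ, E))
    (hmid : ∀ ⦃m : ℕ⦄ ⦃X : Motives.SchemeOver ℂ⦄, Motives.IsSmoothProjective (2 * m) X →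
      ∀ c : complexBetti X (2 * m), IsRationalClass c → IsOfHodgeType (2 * m) X (2 * m) m m c →
        c ∈ algebraicClasses X m)
    {n : ℕ} {X : Motives.SchemeOver ℂ} (hX : Motives.IsSmoothProjective n X) :
    HodgeConjectureFor n X :=
  hodgeConjectureFor_of_middleDimension (middleDimensionReduction_of_multiplicative_deRham hdR)
    (fun _ _ hY ↦ nonempty_hodgeModel_holds hY) hmid hX

end Literature.AlgebraicGeometry.HodgeTheory

end
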